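import Summits.AtomisticToContinuum.Crystallization.Theorems.HullExactificationCascadeRobustBarlowTemplateTransportDefs
import Summits.AtomisticToContinuum.Crystallization.Theorems.HullExactificationCascadeRobustBarlowTemplateDevelopCharts
import Summits.AtomisticToContinuum.Crystallization.Theorems.HullExactificationCascadeRobustBarlowTemplateStubReciprocity
import Summits.AtomisticToContinuum.Crystallization.Theorems.PalmUnimodularRigidityShellsToBarlowChartPowerTranslationA
import Literature.Geometry.DiscreteGeometry.KissingRigidity
import Literature.MathematicalPhysics.StatisticalMechanics.BarlowRings

/-!
# `develop_locsim` for line `registered` (crux `RobustBarlowTemplate`, stmt-AtomisticToContinuum-12088)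

## Statement
`develop_locsim`: a SHELL COVERING `Ψ` of an everywhere-good separated configuration `S` with
reciprocal shells by the ideal stacking `idealStacking s` (`Ψ` maps sites into `S`, the twelve
contacts of every site bijectively onto the first shell of its image, and is faithful on links) is
`1/20`-close to a similarity on every unit cluster of the model (`LocSim s Ψ`): for every site `p`
there are a linear isometry `A` and the scale `l = nnd S (Ψ p) > 0` with
`dist (Ψ q) (Ψ p + l • A (q - p)) ≤ l / 20` for all sites `q` with `dist q p ≤ 1`.

## Proof outline
Fix a site `p`, `y = Ψ p ∈ S`, `d = nnd S y > 0` and a chart `(P, A_y, e)` at `y` with exact links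
(`develop_charts`).  By `pt_exists_frame` the twelve contacts of `p` are `c i = p + ½ A₀ (ref i)`
for the FCC or the HCP reference configuration `ref` (a linear isometry `A₀`), with
`dist (c i) (c j) = 1 ↔ adj i j`.  Star-bijectivity gives `Ψ (c i) = e (v i)` for unique labels
`v i ∈ P`; link-faithfulness of `Ψ` and exactness of the chart links give
`adj i j ↔ dist (v i) (v j) = 1`, and injectivity on the star gives `v i ≠ v j` for `i ≠ j`.  Hence
the doubled labels `x i = 2 • v i` realize the abstract contact pattern on `S²(2)` with separation
`0` (non-adjacent distinct labels are at distance `≥ √2` by the pattern dichotomy), so by the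
rigidity of the FCC / HCP contact pattern (`fcc_rigid` / `hcp_rigid`, Hales 2012, Lemma 10) there
is a linear isometry `L` with `L (ref i) = x i`.  The similarity is `A = A_y ∘ L ∘ A₀⁻¹`, `l = d`:
a site `q` with `dist q p ≤ 1 < √2` is `p` (trivial) or a contact `c i` (gap lemma
`eq_or_dist_eq_of_dist_lt`), and then `A (c i - p) = A_y (L (½ ref i)) = A_y (v i)`, so the chart
estimate `dist (e (v i)) (y + d • A_y (v i)) ≤ d / 20` is the claim.

## Contents
* `locsim_cluster` — the unit-cluster estimate from a chart at `Ψ p` and a frame at `p`, generic in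
  the enumerated reference pattern (FCC or HCP).
* `develop_locsim` — the registered stub.
-/

noncomputable section

namespace Summit.AtomisticToContinuum.Crystallization.Theorems.HullExactificationCascadeRobustBarlowTemplate

open Literature.MathematicalPhysics.StatisticalMechanics Literature.Geometry.DiscreteGeometry
open Summit.AtomisticToContinuum.Crystallization.Theorems.PalmUnimodularRigidityShellsToBarlowChart
  (contacts fcc3Int)
open Summit.AtomisticToContinuum.Crystallization.Theorems.PalmUnimodularRigidityShellsToBarlowChart
  (pt_exists_frame dist_eq_one_or_sqrt_two_le_of_mem_fccKissingPattern
    dist_eq_one_or_sqrt_two_le_of_mem_hcpKissingPattern)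
open RealInnerProductSpace

/-- Euclidean `3`-space. -/
local notation "E3" => EuclideanSpace ℝ (Fin 3)

/-- **The unit-cluster estimate (generic in the reference pattern).**  Let `Ψ` be a shell covering
of `S` by the ideal stacking, `p` a site with positive scale `nnd S (Ψ p)`, `(P, A_y, e)` a chart
at `Ψ p` (a pattern `P` of unit vectors with the pair-distance dichotomy, labelling the shell of
`Ψ p` bijectively, `nnd S (Ψ p) / 20`-close to the rotated scaled pattern, with exact links), and
let the contacts of `p` be framed by the linear isometry `A₀` in the enumerated pattern `tab`
(squared norms `N`, contact relation `|tab i − tab j|² = N`) which is rigid on `S²(2)`.  Then `Ψ`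
is `1/20`-close on the unit cluster of `p` to a similarity of ratio `nnd S (Ψ p)`.
[cite: Hales2012, Lemma 10] -/
theorem locsim_cluster {S : Set E3} {s : ℤ → ℤ} {Ψ : E3 → E3} (hs : IsHaggSeq s)
    (hcov : IsShellCovering S s Ψ) {p : E3} (hp : p ∈ idealStacking s) (hd : 0 < nnd S (Ψ p))
    {P : Finset E3} (hP1 : ∀ v ∈ P, ‖v‖ = 1)
    (hP2 : ∀ v ∈ P, ∀ w ∈ P, v ≠ w → dist v w = 1 ∨ Real.sqrt 2 ≤ dist v w)
    (Ay : E3 →ₗᵢ[ℝ] E3) (e : E3 → E3) (hbij : Set.BijOn e (↑P : Set E3) (shell S (Ψ p)))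
    (hclose : ∀ v ∈ P, dist (e v) (Ψ p + nnd S (Ψ p) • Ay v) ≤ nnd S (Ψ p) / 20)
    (hlink : ∀ v ∈ P, ∀ w ∈ P, (dist v w = 1 ↔ e w ∈ shell S (e v)))
    {N : ℕ} (hN : N ≠ 0) {tab : Fin 12 → Fin 3 → ℤ} (htab : Function.Injective tab)
    (hnorm : ∀ i, sqNormInt (tab i) = N)
    (rigid : ∀ {σ' : ℝ} {x : Fin 12 → E3},
      IsRealization (fun i j => sqNormInt (tab i - tab j) = N) σ' x →
        ∃ L : E3 →ₗᵢ[ℝ] E3, ∀ i, L (refPt N (tab i)) = x i)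
    (A₀ : E3 →ₗᵢ[ℝ] E3)
    (hmem : ∀ i, p + (1 / 2 : ℝ) • A₀ (refPt N (tab i)) ∈ barlowStacking 1 (Real.sqrt (2 / 3)) s)
    (hsurj : ∀ q ∈ barlowStacking 1 (Real.sqrt (2 / 3)) s, dist p q = 1 →
      ∃ i, q = p + (1 / 2 : ℝ) • A₀ (refPt N (tab i))) :
    ∃ A : E3 →ₗᵢ[ℝ] E3, ∃ l : ℝ, 0 < l ∧
      ∀ q ∈ idealStacking s, dist q p ≤ 1 → dist (Ψ q) (Ψ p + l • A (q - p)) ≤ 1 / 20 * l := by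
  have hsq : Real.sqrt (2 / 3) ^ 2 = 2 / 3 * (1 : ℝ) ^ 2 := by
    rw [Real.sq_sqrt (by norm_num)]; norm_num
  have hp' : p ∈ barlowStacking 1 (Real.sqrt (2 / 3)) s := hp
  set ref : Fin 12 → E3 := fun i => refPt N (tab i) with href
  set c : Fin 12 → E3 := fun i => p + (1 / 2 : ℝ) • A₀ (ref i) with hc
  have hcd : ∀ i j, dist (c i) (c j) = 1 / 2 * dist (ref i) (ref j) := by
    intro i j
    simp only [hc, dist_eq_norm, add_sub_add_left_eq_sub, ← smul_sub, ← map_sub, norm_smul,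
      LinearIsometry.norm_map]
    norm_num
  have hadj : ∀ i j, dist (c i) (c j) = 1 ↔ sqNormInt (tab i - tab j) = N := by
    intro i j
    rw [hcd, ← dist_refPt_eq_two_iff hN]
    constructor <;> intro h <;> linarith
  have hcu : ∀ i, dist p (c i) = 1 := by
    intro i
    simp only [hc]
    rw [dist_self_add_right, norm_smul, LinearIsometry.norm_map, href]
    dsimp only
    rw [norm_refPt hN (hnorm i)]
    norm_num
  have hcinj : ∀ i j, c i = c j → i = j := by
    intro i j h
    have h1 : A₀ (ref i) = A₀ (ref j) := by
      have h2 : (1 / 2 : ℝ) • A₀ (ref i) = (1 / 2 : ℝ) • A₀ (ref j) := add_left_cancel h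
      exact smul_right_injective E3 (by norm_num : (1 / 2 : ℝ) ≠ 0) h2
    exact htab (refPt_injective hN (A₀.injective h1))
  have hcm : ∀ i, c i ∈ contacts s p := fun i => ⟨hmem i, hcu i⟩
  -- the star bijection: labels of the images of the contacts
  have hB : Set.BijOn Ψ (contacts s p) (shell S (Ψ p)) := hcov.2.1 p hp
  have hex : ∀ i, ∃ v, v ∈ (↑P : Set E3) ∧ e v = Ψ (c i) := fun i =>
    hbij.surjOn (hB.mapsTo (hcm i))
  choose v hvP hev using hex
  have hvP' : ∀ i, v i ∈ P := fun i => Finset.mem_coe.1 (hvP i)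
  -- links are read off exactly
  have hlinkc : ∀ i j, (sqNormInt (tab i - tab j) = N ↔ dist (v i) (v j) = 1) := by
    intro i j
    rw [← hadj i j, hcov.2.2 p hp (c i) (hcm i) (c j) (hcm j), ← hev i, ← hev j,
      hlink (v i) (hvP' i) (v j) (hvP' j)]
  have hvinj : ∀ i j, v i = v j → i = j := by
    intro i j h
    refine hcinj i j (hB.injOn (hcm i) (hcm j) ?_)
    rw [← hev i, ← hev j, h]
  -- the doubled labels realize the pattern
  set x : Fin 12 → E3 := fun i => (2 : ℝ) • v i with hx
  have hxn : ∀ i, ‖x i‖ = 2 := fun i => by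
    simp only [hx]
    rw [norm_smul, Real.norm_two, hP1 _ (hvP' i), mul_one]
  have hxd : ∀ i j, dist (x i) (x j) = 2 * dist (v i) (v j) := fun i j => by
    simp only [hx]
    rw [dist_eq_norm, ← smul_sub, norm_smul, Real.norm_two, dist_eq_norm]
  have hreal : IsRealization (fun i j => sqNormInt (tab i - tab j) = N) 0 x := by
    refine ⟨by norm_num, fun i => ?_, fun i j hij => ?_, fun i j hij hn => ?_⟩
    · rw [real_inner_self_eq_norm_sq, hxn]; norm_num
    · have h1 : dist (v i) (v j) = 1 := (hlinkc i j).1 hij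
      rw [inner_eq_of_norm_eq_two (hxn i) (hxn j), hxd, h1]; norm_num
    · have hne : v i ≠ v j := fun h => hij (hvinj i j h)
      have hn1 : dist (v i) (v j) ≠ 1 := fun h => hn ((hlinkc i j).2 h)
      have hge : Real.sqrt 2 ≤ dist (v i) (v j) :=
        (hP2 (v i) (hvP' i) (v j) (hvP' j) hne).resolve_left hn1
      rw [inner_eq_of_norm_eq_two (hxn i) (hxn j), hxd]
      have h2 : Real.sqrt 2 ^ 2 = 2 := Real.sq_sqrt (by norm_num)
      nlinarith [mul_le_mul hge hge (Real.sqrt_nonneg 2) dist_nonneg]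
  obtain ⟨L, hL⟩ := rigid hreal
  -- the similarity `q ↦ Ψ p + d • A_y (L (A₀⁻¹ (q - p)))`
  set A₀' : E3 ≃ₗᵢ[ℝ] E3 := A₀.toLinearIsometryEquiv rfl with hA₀'
  refine ⟨Ay.comp (L.comp A₀'.symm.toLinearIsometry), nnd S (Ψ p), hd, fun q hq hqp => ?_⟩
  have hq' : q ∈ barlowStacking 1 (Real.sqrt (2 / 3)) s := hq
  have hlt : dist p q < Real.sqrt 2 * 1 := by
    have h2 : (1 : ℝ) < Real.sqrt 2 := by
      rw [show (1 : ℝ) = Real.sqrt 1 from Real.sqrt_one.symm]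
      exact Real.sqrt_lt_sqrt (by norm_num) (by norm_num)
    rw [dist_comm, mul_one]
    exact hqp.trans_lt h2
  rcases eq_or_dist_eq_of_dist_lt hs one_pos hsq hp' hq' hlt with rfl | h1
  · rw [sub_self, map_zero, smul_zero, add_zero, dist_self]
    linarith
  · obtain ⟨i, rfl⟩ := hsurj q hq' h1
    have e1 : (Ay.comp (L.comp A₀'.symm.toLinearIsometry))
        (p + (1 / 2 : ℝ) • A₀ (refPt N (tab i)) - p) = Ay (v i) := by
      rw [add_sub_cancel_left]
      change Ay (L (A₀'.symm ((1 / 2 : ℝ) • A₀ (ref i)))) = Ay (v i)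
      congr 1
      have e2 : (1 / 2 : ℝ) • A₀ (ref i) = A₀' ((1 / 2 : ℝ) • ref i) := by
        rw [map_smul]; rfl
      rw [e2, A₀'.symm_apply_apply, map_smul, hL]
      simp only [hx]
      rw [smul_smul, show (1 / 2 : ℝ) * 2 = 1 by norm_num, one_smul]
    rw [e1]
    have h3 := hclose (v i) (hvP' i)
    rw [hev i] at h3
    change dist (Ψ (c i)) (Ψ p + nnd S (Ψ p) • Ay (v i)) ≤ 1 / 20 * nnd S (Ψ p)
    linarith

/-- STUB `develop_locsim` (registered skeleton stub): a shell covering of an everywhere-good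
configuration is `1/20`-close to a similarity on every unit cluster. -/
theorem develop_locsim :
    ∀ δ : ℝ, 0 < δ → ∀ S : Set E3, Sep δ S → (∀ y ∈ S, Good S y) → Recip S →
      ∀ (s : ℤ → ℤ) (Ψ : E3 → E3), IsHaggSeq s → IsShellCovering S s Ψ → LocSim s Ψ := by
  intro δ hδ S hSep hG hR s Ψ hs hcov p hp
  have hy : Ψ p ∈ S := hcov.1 hp
  obtain ⟨hd, -⟩ := charts_good_basic (hG _ hy)
  obtain ⟨P, hP, Ay, e, hbij, hclose, hlink⟩ := develop_charts δ hδ S hSep hG hR (Ψ p) hy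
  have hP1 : ∀ v ∈ P, ‖v‖ = 1 := by
    rcases hP with rfl | rfl
    · exact fun v hv => norm_eq_one_of_mem_fccKissingPattern hv
    · exact fun v hv => norm_eq_one_of_mem_hcpKissingPattern hv
  have hP2 : ∀ v ∈ P, ∀ w ∈ P, v ≠ w → dist v w = 1 ∨ Real.sqrt 2 ≤ dist v w := by
    rcases hP with rfl | rfl
    · exact fun v hv w hw hvw => dist_eq_one_or_sqrt_two_le_of_mem_fccKissingPattern hv hw hvw
    · exact fun v hv w hw hvw => dist_eq_one_or_sqrt_two_le_of_mem_hcpKissingPattern hv hw hvw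
  obtain ⟨A₀, hA | hA⟩ := pt_exists_frame hs hp
  · exact locsim_cluster hs hcov hp hd hP1 hP2 Ay e hbij hclose hlink two_ne_zero
      fccTab_injective (by decide) (fun hx => fcc_rigid hx) A₀ hA.1 hA.2
  · exact locsim_cluster hs hcov hp hd hP1 hP2 Ay e hbij hclose hlink (by norm_num)
      hcpTab_injective (by decide) (fun hx => hcp_rigid hx) A₀ hA.1 hA.2

end Summit.AtomisticToContinuum.Crystallization.Theorems.HullExactificationCascadeRobustBarlowTemplate

end
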